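import Literature.AlgebraicGeometry.Resolution.WeightedCentreInvariantDirection
import Mathlib.Algebra.MvPolynomial.Rename
import Mathlib.Algebra.Polynomial.AlgebraMap
import Mathlib.Logic.Equiv.Basic
import HarnessLib

/-!
# The two-parameter Hasse expansion `G(ε + λv + μv′)` and commuting directional Hasse derivatives
# (instrument, NOT a resolution theorem)

Engine 1 of the RESOLUTION OBSERVATORY toy model `W(f)` (CARVER-NOTES-eng1-g41 T92, "the two-parameter Hasse expansion
`G(x + λv + μv′) = Σ λ^k μ^l Δ^{(k)}_v Δ^{(l)}_{v′} G` with commuting `Δ`'s").  With `lineShift v G = G(ε + t·v) = Σ_k t^k Δ_v^{(k)} G`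
of `WeightedCentreInvariantDirection` (`Δ_v^{(k)} G := (lineShift v G).coeff k`, the `k`-th Hasse derivative along the constant
direction `v`):

* `lineShift₂ v v' G = G(ε + λ·v + μ·v′) ∈ K[ε][λ, μ]` (`λ = X 0`, `μ = X 1` of `MvPolynomial (Fin 2) K[ε]`);
* `coeff_lineShift₂`: its `λ^k μ^l`-coefficient is `Δ_v^{(k)} Δ_{v′}^{(l)} G` — the two-parameter Hasse expansion;
* `hasseDeriv_comm`: `Δ_v^{(k)} Δ_{v′}^{(l)} = Δ_{v′}^{(l)} Δ_v^{(k)}` (swap `λ ↔ μ`);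
* `IsInvariantDir.coeff_lineShift`: an invariant direction of `G` is an invariant direction of every `Δ_{v′}^{(l)} G`.

The bridge `Polynomial (Polynomial K[ε]) → MvPolynomial (Fin 2) K[ε]` (`bridge`, `coeff_bridge`) identifies the iterated one-parameter
shifts with the two-parameter one.  Classical (Taylor expansion in two commuting parameters / Hasse–Schmidt derivations on a polynomial
ring) [Lang2002, Ch. IV §1; Matsumura1987, §27 (p. 207)]; statements OURS in this packaging.
-/

namespace Literature.AlgebraicGeometry.Resolution.WeightedBlowup

namespace DoubleShift

open MvPolynomial InvariantDirection

variable {K : Type*} [CommRing K] {ι : Type*}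

/-! ## The bridge `A[s][t] → A[λ, μ]` -/

section Bridge

variable {A : Type*} [CommRing A]

/-- The `A`-algebra map `A[s][t] → MvPolynomial (Fin 2) A`, `s ↦ X 0`, `t ↦ X 1` (ours, bookkeeping). [cite: Lang2002, Ch. IV §1] -/
noncomputable def bridge : Polynomial (Polynomial A) →ₐ[A] MvPolynomial (Fin 2) A :=
  Polynomial.aevalTower (Polynomial.aeval (X 0)) (X 1)

/-- `t ↦ μ` (ours, bookkeeping). [cite: Lang2002, Ch. IV §1] -/
@[simp] theorem bridge_X : bridge (Polynomial.X : Polynomial (Polynomial A)) = X 1 :=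
  Polynomial.aevalTower_X _ _

/-- `s ↦ λ` (ours, bookkeeping). [cite: Lang2002, Ch. IV §1] -/
@[simp] theorem bridge_C_X : bridge (Polynomial.C Polynomial.X : Polynomial (Polynomial A)) = X 0 := by
  rw [bridge, Polynomial.aevalTower_C, Polynomial.aeval_X]

/-- Constants (ours, bookkeeping). [cite: Lang2002, Ch. IV §1] -/
@[simp] theorem bridge_C_C (a : A) : bridge (Polynomial.C (Polynomial.C a)) = C a := by
  rw [bridge, Polynomial.aevalTower_C, Polynomial.aeval_C, MvPolynomial.algebraMap_eq]

/-- **The bridge reads off double coefficients** (ours): the `λ^k μ^l`-coefficient of `bridge F` is `(F.coeff l).coeff k`.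
[cite: Lang2002, Ch. IV §1] -/
theorem coeff_bridge (F : Polynomial (Polynomial A)) (k l : ℕ) :
    MvPolynomial.coeff (Finsupp.single 0 k + Finsupp.single 1 l) (bridge F) = (F.coeff l).coeff k := by
  classical
  -- exponent vectors on `Fin 2`: `single 0 m + single 1 n` determines `(m, n)` (cf. `Dioph.single_add_single_inj`)
  have hinj : ∀ {m n : ℕ}, (Finsupp.single (0 : Fin 2) m + Finsupp.single 1 n = Finsupp.single 0 k + Finsupp.single 1 l) →
      m = k ∧ n = l := by
    intro m n h
    have h0 := DFunLike.congr_fun h 0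
    have h1 := DFunLike.congr_fun h 1
    simp only [Finsupp.add_apply, Finsupp.single_apply] at h0 h1
    simp at h0 h1
    exact ⟨h0, h1⟩
  induction F using Polynomial.induction_on' with
  | add p q hp hq => rw [map_add, coeff_add, hp, hq, Polynomial.coeff_add, Polynomial.coeff_add]
  | monomial n a =>
    rw [Polynomial.coeff_monomial]
    induction a using Polynomial.induction_on' with
    | add p q hp hq =>
      rw [map_add, map_add, coeff_add, hp, hq]
      split_ifs <;> simp
    | monomial m c =>
      have e : bridge (Polynomial.monomial n (Polynomial.monomial m c) : Polynomial (Polynomial A))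
          = MvPolynomial.monomial (Finsupp.single 0 m + Finsupp.single 1 n) c := by
        rw [← Polynomial.C_mul_X_pow_eq_monomial, ← Polynomial.C_mul_X_pow_eq_monomial, map_mul, map_pow, bridge_X,
          Polynomial.C_mul, Polynomial.C_pow, map_mul, map_pow, bridge_C_C, bridge_C_X, X_pow_eq_monomial,
          X_pow_eq_monomial, C_mul_monomial, monomial_mul, mul_one, mul_one]
      rw [e, coeff_monomial]
      by_cases hnl : n = l
      · subst hnl
        rw [if_pos rfl, Polynomial.coeff_monomial]
        by_cases hmk : m = k
        · subst hmk; rw [if_pos rfl, if_pos rfl]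
        · rw [if_neg hmk, if_neg fun h => hmk (hinj h).1]
      · rw [if_neg hnl, Polynomial.coeff_zero, if_neg fun h => hnl (hinj h).2]

end Bridge

/-! ## The two-parameter shift -/

/-- **`G(ε + λ·v + μ·v′)`** (ours): the two-parameter family of translations, `λ = X 0`, `μ = X 1`. [cite: Lang2002, Ch. IV §1] -/
noncomputable def lineShift₂ (v v' : ι → K) : MvPolynomial ι K →ₐ[K] MvPolynomial (Fin 2) (MvPolynomial ι K) :=
  aeval fun i => C (X i) + X 0 * C (C (v i)) + X 1 * C (C (v' i))

/-- On a variable (ours, bookkeeping). [cite: Lang2002, Ch. IV §1] -/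
@[simp] theorem lineShift₂_X (v v' : ι → K) (i : ι) :
    lineShift₂ v v' (X i) = C (X i) + X 0 * C (C (v i)) + X 1 * C (C (v' i)) :=
  aeval_X _ i

/-- On scalars (ours, bookkeeping). [cite: Lang2002, Ch. IV §1] -/
@[simp] theorem lineShift₂_C (v v' : ι → K) (a : K) : lineShift₂ v v' (C a) = C (C a) := by
  rw [lineShift₂, aeval_C, IsScalarTower.algebraMap_apply K (MvPolynomial ι K) (MvPolynomial (Fin 2) (MvPolynomial ι K)),
    MvPolynomial.algebraMap_eq, MvPolynomial.algebraMap_eq]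

/-- **Iterated one-parameter shifts = the two-parameter shift** (ours): shifting by `v′` (parameter `t`) and then each coefficient by
`v` (parameter `s`) is `G(ε + s·v + t·v′)` under the bridge `s ↦ λ`, `t ↦ μ`. [cite: Lang2002, Ch. IV §1; Matsumura1987, §27 (p. 207)] -/
theorem bridge_map_lineShift_lineShift (v v' : ι → K) (G : MvPolynomial ι K) :
    bridge (Polynomial.map (lineShift v).toRingHom (lineShift v' G)) = lineShift₂ v v' G := by
  induction G using MvPolynomial.induction_on with
  | C a =>
    rw [lineShift_C, Polynomial.map_C, lineShift₂_C]
    show bridge (Polynomial.C (lineShift v (C a))) = _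
    rw [lineShift_C, bridge_C_C]
  | add p q hp hq => rw [map_add, Polynomial.map_add, map_add, hp, hq, map_add]
  | mul_X p j hp =>
    rw [map_mul, Polynomial.map_mul, map_mul, hp, map_mul, lineShift_X, lineShift₂_X]
    congr 1
    rw [Polynomial.map_add, Polynomial.map_mul, Polynomial.map_C, Polynomial.map_C, Polynomial.map_X]
    show bridge (Polynomial.C (lineShift v (X j)) + Polynomial.X * Polynomial.C (lineShift v (C (v' j)))) = _
    simp only [lineShift_X, lineShift_C, map_add, map_mul, bridge_X, bridge_C_C, bridge_C_X]

/-- Swapping the two parameters swaps the two directions (ours). [cite: Lang2002, Ch. IV §1] -/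
theorem lineShift₂_swap (v v' : ι → K) (G : MvPolynomial ι K) :
    lineShift₂ v' v G = rename (Equiv.swap (0 : Fin 2) 1) (lineShift₂ v v' G) := by
  have key : lineShift₂ v' v = ((rename (Equiv.swap (0 : Fin 2) 1)).restrictScalars K).comp (lineShift₂ v v') := by
    refine MvPolynomial.algHom_ext fun i => ?_
    simp only [AlgHom.comp_apply, AlgHom.restrictScalars_apply, lineShift₂_X, map_add, map_mul, rename_C, rename_X,
      Equiv.swap_apply_left, Equiv.swap_apply_right]
    ring
  exact congrArg (fun φ : MvPolynomial ι K →ₐ[K] MvPolynomial (Fin 2) (MvPolynomial ι K) => φ G) key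

/-- **The two-parameter Hasse expansion** (ours): the `λ^k μ^l`-coefficient of `G(ε + λv + μv′)` is `Δ_v^{(k)} Δ_{v′}^{(l)} G`, where
`Δ_u^{(n)} F = (lineShift u F).coeff n`. [cite: Lang2002, Ch. IV §1; Matsumura1987, §27 (p. 207)] -/
theorem coeff_lineShift₂ (v v' : ι → K) (G : MvPolynomial ι K) (k l : ℕ) :
    MvPolynomial.coeff (Finsupp.single 0 k + Finsupp.single 1 l) (lineShift₂ v v' G)
      = (lineShift v ((lineShift v' G).coeff l)).coeff k := by
  rw [← bridge_map_lineShift_lineShift, coeff_bridge, Polynomial.coeff_map]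
  rfl

/-- The same for an arbitrary exponent vector `d` on `Fin 2` (ours). [cite: Lang2002, Ch. IV §1] -/
theorem coeff_lineShift₂' (v v' : ι → K) (G : MvPolynomial ι K) (d : Fin 2 →₀ ℕ) :
    MvPolynomial.coeff d (lineShift₂ v v' G) = (lineShift v ((lineShift v' G).coeff (d 1))).coeff (d 0) := by
  -- `d = single 0 (d 0) + single 1 (d 1)` (cf. `EllipticCurves.finsupp_fin_two_eq`)
  have hd : d = Finsupp.single 0 (d 0) + Finsupp.single 1 (d 1) := by
    ext i
    fin_cases i <;> simp
  rw [hd, coeff_lineShift₂]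
  simp

/-- **Directional Hasse derivatives commute** (ours): `Δ_v^{(k)} Δ_{v′}^{(l)} G = Δ_{v′}^{(l)} Δ_v^{(k)} G`.
[cite: Lang2002, Ch. IV §1; Matsumura1987, §27 (p. 207)] -/
theorem hasseDeriv_comm (v v' : ι → K) (G : MvPolynomial ι K) (k l : ℕ) :
    (lineShift v ((lineShift v' G).coeff l)).coeff k = (lineShift v' ((lineShift v G).coeff k)).coeff l := by
  rw [← coeff_lineShift₂, ← coeff_lineShift₂, lineShift₂_swap v v' G]
  have e : (Finsupp.single (0 : Fin 2) l + Finsupp.single 1 k)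
      = Finsupp.mapDomain (Equiv.swap (0 : Fin 2) 1) (Finsupp.single 0 k + Finsupp.single 1 l) := by
    rw [Finsupp.mapDomain_add, Finsupp.mapDomain_single, Finsupp.mapDomain_single, Equiv.swap_apply_left,
      Equiv.swap_apply_right, add_comm]
  rw [e, coeff_rename_mapDomain _ (Equiv.injective _)]

/-- **An invariant direction of `G` is an invariant direction of every Hasse derivative `Δ_{v′}^{(l)} G`** (ours) — the commutation
at work. [cite: Lang2002, Ch. IV §1] -/
theorem _root_.Literature.AlgebraicGeometry.Resolution.WeightedBlowup.InvariantDirection.IsInvariantDir.coeff_lineShift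
    {G : MvPolynomial ι K} {v : ι → K} (hv : IsInvariantDir G v) (v' : ι → K) (l : ℕ) :
    IsInvariantDir ((lineShift v' G).coeff l) v := by
  have hv' : lineShift v G = Polynomial.C G := hv
  unfold IsInvariantDir
  refine Polynomial.ext fun k => ?_
  rw [hasseDeriv_comm, Polynomial.coeff_C, hv', Polynomial.coeff_C]
  by_cases hk : k = 0
  · subst hk; rw [if_pos rfl, if_pos rfl]
  · rw [if_neg hk, if_neg hk, map_zero, Polynomial.coeff_zero]

/-- In particular (ours): along an invariant direction `v` of `G`, `G(ε + λv + μv′)` has no `λ`: every coefficient with `k ≥ 1`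
vanishes, i.e. `G(ε + λv + μv′) = G(ε + μv′)`. [cite: Lang2002, Ch. IV §1] -/
theorem coeff_lineShift₂_eq_zero_of_isInvariantDir {G : MvPolynomial ι K} {v : ι → K} (hv : IsInvariantDir G v) (v' : ι → K)
    {k : ℕ} (hk : k ≠ 0) (l : ℕ) : MvPolynomial.coeff (Finsupp.single 0 k + Finsupp.single 1 l) (lineShift₂ v v' G) = 0 := by
  rw [coeff_lineShift₂]
  have h : lineShift v ((lineShift v' G).coeff l) = Polynomial.C ((lineShift v' G).coeff l) := hv.coeff_lineShift v' l
  rw [h, Polynomial.coeff_C, if_neg hk]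

/-! ## Smoke test -/

section Test

/-- `G = ε₀` over `ℤ`, `v = e₀`, `v′ = e₁`: `G(ε + λe₀ + μe₁) = ε₀ + λ`, whose `λ¹μ⁰`-coefficient is `1 = Δ_{e₀}^{(1)} G`. -/
example : MvPolynomial.coeff (Finsupp.single 0 1 + Finsupp.single 1 0)
    (lineShift₂ (Pi.single 0 1) (Pi.single 1 1) (X 0 : MvPolynomial (Fin 2) ℤ)) = 1 := by
  classical
  rw [lineShift₂_X]
  simp only [Pi.single_eq_same, Pi.single_eq_of_ne (h := (by decide : (0 : Fin 2) ≠ 1)), map_zero, map_one, mul_zero,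
    add_zero, mul_one, Finsupp.single_zero, coeff_add, coeff_C, coeff_X]
  rw [if_neg fun h => by simpa using DFunLike.congr_fun h 0, zero_add]
  simp

end Test

end DoubleShift

end Literature.AlgebraicGeometry.Resolution.WeightedBlowup
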